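import Literature.NumberTheory.Transcendental.LineODEGens
import Literature.NumberTheory.Transcendental.UnivExtChartTheta
import Literature.NumberTheory.Transcendental.LineJetsBasic
import Literature.NumberTheory.Transcendental.PkappaThetaPoints
import HarnessLib

/-!
# The chart coordinates of `M_κ` as polynomials in the line generators; the jet formula

Topic: `Literature/NumberTheory/Transcendental`. Plan item W4 ("LineODE", part 2) of the unit
`provefact-Literature.NumberTheory.Transcendental.H-b596640137`. With the generators
`genFun` of `LineODEGens.lean` (torus `E_j`, per factor `(℘, ℘′, ζ)` or `(u, p, g)`, fibre `S_e`)
and the chart choice `c`, the affine chart coordinates `A_J = Θ_J/Θ_{J₀(c)}` of `M_κ`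
(`LineJetsBasic.lean`, `J₀(c) = (none, (M₀, none))`, `M₀(b) = 2` in the origin chart and `0` in the
generic chart) are the values of explicit POLYNOMIALS `HPoly c κ J ∈ ℚ̄(g₂, g₃)[Gen]` in the
generators `E_j`, `(℘_b, ℘′_b)`/`(u_b, p_b)`, `Ñ_e` of `LineODEGens.lean`:

* `rPoly`: `P_i/P_{i₀}` = generic `(1, ℘, ℘′)`, origin chart `(u, p, 1)`;
* `corrPoly`: `Z_i/P_{i₀} - ζ̂·(P_i/P_{i₀})` = generic `(0, 0, 2℘²)`, origin chart
  `(-2p², -1/2 - (g₂/2)pu - (g₃/2)u², 0)` (`UnivExtTheta.univExtZ_eq`,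
  `UnivExtChartTheta.univExtZ_div_univExtP_two`) — the `ζ̂`-parts of all factors recombine with
  `s'_e` into the single generator `Ñ_e = s'_e - ∑_b κ_{eb} ζ̂_b`;
* `HPoly (a, (M, none)) = T_a ∏_b rPoly_{M b}`,
  `HPoly (a, (M, some e)) = T_a (Ñ_e ∏_b rPoly_{M b} - ∑_b κ_{eb} corrPoly_{M b} ∏_{b'≠b} rPoly_{M b'})`,
  `T_none = 1`, `T_{some j} = E_j` (the definition of `GaGmE.Std.theta`, `PkappaTheta.lean`, in the
  form `PkappaThetaPoints.thetaPsome_eq_mul_prod`).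

PROVED: `chartCoord_baseIdx_eq_eval` — on the chart domain,
`A_J(w + ξx) = HPoly_J(genFun ξ)`; and the **jet formula** `vanishesAlong_thetaEval_iff_der`:
for a form `P` of degree `D` and a chart choice valid at `w`,
`VanishesAlong 𝔟 F_P w N ⟺ ∀ x ∈ 𝔟, ∀ k < N, (D_x^k (P ∘ HPoly))(genFun_{w,x}(0)) = 0`,
`D_x` the derivation `PolyODE.der (genODE c x)` — Baker's "the derivatives of the auxiliary
function at the points are polynomials in the same numbers" in the present setting.

## References

* A. Baker, G. Wüstholz, *Logarithmic Forms and Diophantine Geometry*, CUP 2007, §6.7–6.8.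
* A. Baker, *Transcendental Number Theory*, CUP 1975, Ch. 2 §3.
-/

noncomputable section

open Complex Filter Topology MvPolynomial
open scoped PeriodPair

namespace Literature.NumberTheory.Transcendental

namespace GaGmE

namespace Std

variable {β γ δ : Type} [Fintype β] [Fintype γ] [Fintype δ] [DecidableEq γ]
variable (L : PeriodPair) (κM : δ → γ → Kbar)

/-! ### The polynomials -/

/-- The base index of a factor chart: `P₂` in the origin chart, `P₀ = σ³` in the generic one.
[folklore] -/
def baseFin (lat : Bool) : Fin 3 := if lat then 2 else 0

/-- The chart index `J₀(c) = (none, (M₀, none))`, `M₀ b = baseFin (c b)`. [folklore] -/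
def baseIdx (c : γ → Bool) : Option β × ThetaIdx γ δ := (none, (fun b => baseFin (c b), none))

/-- `P_i/P_{i₀}` as a polynomial in the factor generators: generic `(1, X₀, X₁)`, origin chart
`(X₀, X₁, 1)`. [folklore] -/
def rPoly (lat : Bool) (b : γ) (i : Fin 3) : MvPolynomial (Gen β γ δ) ℂ :=
  let X0 : MvPolynomial (Gen β γ δ) ℂ := X (Sum.inr (Sum.inl (b, 0)))
  let X1 : MvPolynomial (Gen β γ δ) ℂ := X (Sum.inr (Sum.inl (b, 1)))
  if lat then ![X0, X1, 1] i else ![1, X0, X1] i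

/-- The `ζ̂`-free part of `Z_i/P_{i₀}` as a polynomial in the factor generators: generic
`(0, 0, 2X₀²)`, origin chart `(-2X₁², -1/2 - (g₂/2)X₁X₀ - (g₃/2)X₀², 0)`. [folklore] -/
def corrPoly (lat : Bool) (b : γ) (i : Fin 3) : MvPolynomial (Gen β γ δ) ℂ :=
  let X0 : MvPolynomial (Gen β γ δ) ℂ := X (Sum.inr (Sum.inl (b, 0)))
  let X1 : MvPolynomial (Gen β γ δ) ℂ := X (Sum.inr (Sum.inl (b, 1)))
  if lat then
    ![-2 * X1 ^ 2, -(C (1 / 2)) - C (L.g₂ / 2) * X1 * X0 - C (L.g₃ / 2) * X0 ^ 2, 0] i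
  else ![0, 0, 2 * X0 ^ 2] i

/-- The torus coordinate polynomial: `T_none = 1`, `T_{some j} = E_j`. [folklore] -/
def TPoly : Option β → MvPolynomial (Gen β γ δ) ℂ
  | none => 1
  | some j => X (Sum.inl j)

/-- **The chart coordinates as polynomials in the generators.** [folklore] -/
def HPoly (c : γ → Bool) : Option β × ThetaIdx γ δ → MvPolynomial (Gen β γ δ) ℂ
  | (a, (M, none)) => TPoly a * ∏ b, rPoly (c b) b (M b)
  | (a, (M, some e)) => TPoly a *
      (X (Sum.inr (Sum.inr e)) * ∏ b, rPoly (c b) b (M b) -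
        ∑ b, C (κM e b : ℂ) * (corrPoly L (c b) b (M b) * ∏ b' ∈ Finset.univ.erase b, rPoly (c b') b' (M b')))

/-! ### Values of the factor polynomials -/

/-- The value of `rPoly` at the generators of the point `z`. [folklore] -/
def rVal (lat : Bool) (i : Fin 3) (z : ℂ) : ℂ :=
  if lat then ![L.latU z, L.latP z, 1] i else ![1, ℘[L] z, ℘'[L] z] i

/-- The value of `corrPoly` at the generators of the point `z`. [folklore] -/
def corrVal (lat : Bool) (i : Fin 3) (z : ℂ) : ℂ :=
  if lat then
    ![-2 * L.latP z ^ 2, -(1 / 2) - L.g₂ / 2 * L.latP z * L.latU z - L.g₃ / 2 * L.latU z ^ 2, 0] i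
  else ![0, 0, 2 * ℘[L] z ^ 2] i

variable {L}

omit [Fintype β] [Fintype δ] [DecidableEq γ] in
/-- `rPoly` evaluates to `rVal` at the generators along the line. [folklore] -/
theorem eval_rPoly (c : γ → Bool) (w x : β ⊕ (γ ⊕ δ) → ℂ) (ξ : ℂ) (b : γ) (i : Fin 3) :
    MvPolynomial.eval (genFun L κM c w x ξ) (rPoly (c b) b i) =
      rVal L (c b) i (w (iz b) + ξ * x (iz b)) := by
  cases hc : c b <;> fin_cases i <;> simp [rPoly, rVal, genFun, hc]

omit [Fintype β] [Fintype δ] [DecidableEq γ] in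
/-- `corrPoly` evaluates to `corrVal` at the generators along the line. [folklore] -/
theorem eval_corrPoly (c : γ → Bool) (w x : β ⊕ (γ ⊕ δ) → ℂ) (ξ : ℂ) (b : γ) (i : Fin 3) :
    MvPolynomial.eval (genFun L κM c w x ξ) (corrPoly L (c b) b i) =
      corrVal L (c b) i (w (iz b) + ξ * x (iz b)) := by
  cases hc : c b <;> fin_cases i <;> simp [corrPoly, corrVal, genFun, hc]

/-- **Factor blocks in a valid chart**: `P_{i₀} ≠ 0`, `P_i = rVal_i · P_{i₀}`,
`Z_i = (ζ̂ · rVal_i + corrVal_i) · P_{i₀}`. [folklore] -/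
theorem factor_blocks (lat : Bool) {z : ℂ} (hv : FactorChartValid L lat z) (i : Fin 3) :
    L.univExtP (baseFin lat) z ≠ 0 ∧
      L.univExtP i z = rVal L lat i z * L.univExtP (baseFin lat) z ∧
      L.univExtZ i z = (zetaHat L lat z * rVal L lat i z + corrVal L lat i z) *
        L.univExtP (baseFin lat) z := by
  cases lat
  · -- generic chart: base `P₀ = σ³`
    have hz : z ∉ L.lattice := by simpa [FactorChartValid] using hv
    have hσ : L.weierstrassSigma z ^ 3 ≠ 0 := pow_ne_zero _ (L.weierstrassSigma_ne_zero hz)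
    obtain ⟨p0, p1, p2⟩ := PeriodPair.univExtP_eq hz
    obtain ⟨z0, z1, z2⟩ := PeriodPair.univExtZ_eq hz
    simp only [baseFin, Bool.false_eq_true, if_false]
    refine ⟨by rwa [p0], ?_, ?_⟩
    · fin_cases i <;> simp [rVal, p0, p1, p2] <;> ring
    · fin_cases i <;> simp [rVal, corrVal, p0, z0, z1, z2] <;> ring
  · -- origin chart: base `P₂`
    have h2 : L.univExtP 2 z ≠ 0 := by simpa [FactorChartValid] using hv
    obtain ⟨q0, q1, q2⟩ := PeriodPair.univExtZ_div_univExtP_two h2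
    simp only [baseFin, if_true]
    refine ⟨h2, ?_, ?_⟩
    · fin_cases i
      · simp only [rVal, if_true, Fin.zero_eta, Matrix.cons_val_zero, PeriodPair.latU]
        field_simp
      · simp only [rVal, if_true, Fin.mk_one, Matrix.cons_val_one, Matrix.cons_val_zero,
          PeriodPair.latP]
        field_simp
      · simp [rVal]
    · fin_cases i
      · have e0 : L.univExtZ 0 z = (L.latG z * L.latU z - 2 * L.latP z ^ 2) * L.univExtP 2 z := by
          rw [← q0]; field_simp
        show L.univExtZ 0 z = _
        rw [e0]; congr 1; simp [rVal, corrVal]; ring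
      · have e1 : L.univExtZ 1 z = (L.latG z * L.latP z - 1 / 2 - L.g₂ / 2 * L.latP z * L.latU z -
            L.g₃ / 2 * L.latU z ^ 2) * L.univExtP 2 z := by
          rw [← q1]; field_simp
        show L.univExtZ 1 z = _
        rw [e1]; congr 1; simp [rVal, corrVal]; ring
      · have e2 : L.univExtZ 2 z = L.latG z * L.univExtP 2 z := by
          rw [← q2]; field_simp
        show L.univExtZ 2 z = _
        rw [e2]; congr 1; simp [rVal, corrVal]

/-! ### The chart coordinates along the line -/

omit [Fintype β] [Fintype δ] in
/-- The base theta function along the line is the product of the factor bases: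
`Θ_{J₀(c)}(w') = ∏_b P_{i₀(b)}(z'_b)`. [folklore] -/
theorem theta_baseIdx (c : γ → Bool) (w' : β ⊕ (γ ⊕ δ) → ℂ) :
    theta L κM (baseIdx c) w' = ∏ b, L.univExtP (baseFin (c b)) (w' (iz b)) := by
  simp [baseIdx, theta, thetaPnone]

omit [Fintype β] [Fintype γ] [Fintype δ] [DecidableEq γ] in
/-- Coordinates of a point of the line. [folklore] -/
theorem line_apply (w x : β ⊕ (γ ⊕ δ) → ℂ) (ξ : ℂ) (k : β ⊕ (γ ⊕ δ)) :
    (w + ξ • x) k = w k + ξ * x k := by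
  simp

omit [Fintype β] [Fintype δ] in
/-- **The chart coordinates are the polynomials `HPoly` in the generators**: for `ξ` in the
chart domain and every index `J`, `A_J(w + ξx) = HPoly_J(genFun(ξ))`. [folklore] -/
theorem chartCoord_baseIdx_eq_eval (c : γ → Bool) (w x : β ⊕ (γ ⊕ δ) → ℂ) {ξ : ℂ}
    (hξ : ξ ∈ chartDomain L c w x) (J : Option β × ThetaIdx γ δ) :
    chartCoord L κM (baseIdx c) J (w + ξ • x) =
      MvPolynomial.eval (genFun L κM c w x ξ) (HPoly L κM c J) := by
  set w' : β ⊕ (γ ⊕ δ) → ℂ := w + ξ • x with hw'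
  have hco : ∀ k, w' k = w k + ξ * x k := fun k => line_apply w x ξ k
  -- the factor data at the points `z'_b`
  set d : γ → ℂ := fun b => L.univExtP (baseFin (c b)) (w' (iz b)) with hd
  set r : γ → ℂ := fun b => rVal L (c b) ((J.2).1 b) (w' (iz b)) with hr
  set q : γ → ℂ := fun b => corrVal L (c b) ((J.2).1 b) (w' (iz b)) with hq
  set t' : γ → ℂ := fun b => zetaHat L (c b) (w' (iz b)) with ht'
  have hblk : ∀ b, d b ≠ 0 ∧ L.univExtP ((J.2).1 b) (w' (iz b)) = r b * d b ∧
      L.univExtZ ((J.2).1 b) (w' (iz b)) = (t' b * r b + q b) * d b := fun b => by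
    have hv : FactorChartValid L (c b) (w' (iz b)) := by rw [hco]; exact hξ b
    exact factor_blocks (c b) hv _
  have hD : (∏ b, d b) ≠ 0 := Finset.prod_ne_zero_iff.mpr fun b _ => (hblk b).1
  have hbase : theta L κM (baseIdx c) w' = ∏ b, d b := theta_baseIdx κM c w'
  -- values of the building blocks at the generators
  have er : ∀ b, MvPolynomial.eval (genFun L κM c w x ξ) (rPoly (c b) b ((J.2).1 b)) = r b :=
    fun b => by rw [eval_rPoly]; simp only [hr, hco]
  have eq_ : ∀ b, MvPolynomial.eval (genFun L κM c w x ξ) (corrPoly L (c b) b ((J.2).1 b)) = q b :=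
    fun b => by rw [eval_corrPoly]; simp only [hq, hco]
  have eT : ∀ a : Option β, MvPolynomial.eval (genFun L κM c w x ξ) (TPoly a) = thetaT (γ := γ) (δ := δ) a w' := by
    rintro (_ | j)
    · simp [TPoly]
    · simp [TPoly, genFun, hco]
  have hnone : ∀ M : γ → Fin 3, (∀ b, L.univExtP (M b) (w' (iz b)) = r b * d b) →
      thetaPnone (β := β) (δ := δ) L M w' = (∏ b, r b) * ∏ b, d b := fun M hP => by
    unfold thetaPnone
    rw [← Finset.prod_mul_distrib]
    exact Finset.prod_congr rfl fun b _ => hP b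
  rcases J with ⟨a, M, _ | e⟩
  · -- `J = (a, (M, none))`
    have hP : ∀ b, L.univExtP (M b) (w' (iz b)) = r b * d b := fun b => (hblk b).2.1
    rw [chartCoord, hbase, theta, thetaP_none, hnone M hP, HPoly, map_mul, map_prod, eT,
      Finset.prod_congr rfl fun b _ => er b]
    field_simp
  · -- `J = (a, (M, some e))`
    have hP : ∀ b, L.univExtP (M b) (w' (iz b)) = r b * d b := fun b => (hblk b).2.1
    have hZ : ∀ b, L.univExtZ (M b) (w' (iz b)) = (t' b * r b - (-q b)) * d b := fun b => by
      rw [(hblk b).2.2]; ring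
    have hsome := thetaPsome_eq_mul_prod L κM M e w' d r (fun b => -q b) t' hP hZ
    rw [chartCoord, hbase, theta, thetaP_some, hsome, HPoly, map_mul, eT]
    simp only [map_sub, map_mul, map_sum, map_prod, eval_X, eval_C, er, eq_]
    have hS : genFun L κM c w x ξ (Sum.inr (Sum.inr e)) = w' (is e) - ∑ b, (κM e b : ℂ) * t' b := by
      simp [genFun, ht', hco]
    rw [hS]
    field_simp
    simp only [Finset.sum_neg_distrib]
    ring

/-! ### The jet formula -/

/-- **Jets of forms along lines are values of polynomials.** For a form `P` of degree `D`, a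
point `w`, a chart choice `c` valid at `w` along every direction (e.g. `chartChoiceAt L w`) and
`N`: `F_P` vanishes to order `≥ N` at `w` along `𝔟` iff for every `x ∈ 𝔟` and `k < N` the
polynomial `D_x^k(P ∘ HPoly)` vanishes at the generators `genFun_{w,x}(0)` — where
`D_x = PolyODE.der (genODE c x)`. [cite: BakerWustholz2007, §6.8 (p. 119)] -/
theorem vanishesAlong_thetaEval_iff_der {P : MvPolynomial (Option β × ThetaIdx γ δ) ℂ} {D : ℕ}
    (hP : P.IsHomogeneous D) (c : γ → Bool) (𝔟 : Submodule ℂ (β ⊕ (γ ⊕ δ) → ℂ))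
    {w : β ⊕ (γ ⊕ δ) → ℂ} (hc : ∀ x : β ⊕ (γ ⊕ δ) → ℂ, (0 : ℂ) ∈ chartDomain L c w x) (N : ℕ) :
    VanishesAlong 𝔟 (thetaEval L κM P) w N ↔
      ∀ x ∈ 𝔟, ∀ k < N,
        MvPolynomial.eval (genFun L κM c w x 0)
          ((PolyODE.der (genODE L κM c x))^[k] (MvPolynomial.bind₁ (HPoly L κM c) P)) = 0 := by
  -- `Θ_{J₀}(w) ≠ 0`
  have h0 : theta L κM (baseIdx c) w ≠ 0 := by
    rw [theta_baseIdx]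
    refine Finset.prod_ne_zero_iff.mpr fun b _ => ?_
    have hv := hc 0 b
    simp only [zero_mul, add_zero] at hv
    exact (factor_blocks (c b) hv 0).1
  rw [vanishesAlong_thetaEval_iff_chart L κM hP (baseIdx c) 𝔟 h0 N]
  refine forall₂_congr fun x _ => forall₂_congr fun k _ => ?_
  -- near `ξ = 0` the chart expression is `(P ∘ HPoly)(genFun ξ)`
  have hopen := isOpen_chartDomain L c w x
  have hev : ∀ᶠ ξ in 𝓝 (0 : ℂ), ξ ∈ chartDomain L c w x := hopen.mem_nhds (hc x)
  have heq : (fun ξ : ℂ => MvPolynomial.eval (fun J => chartCoord L κM (baseIdx c) J (w + ξ • x)) P)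
      =ᶠ[𝓝 0] fun ξ => MvPolynomial.eval (genFun L κM c w x ξ) (MvPolynomial.bind₁ (HPoly L κM c) P) := by
    filter_upwards [hev] with ξ hξ
    have hb : MvPolynomial.eval (genFun L κM c w x ξ) (MvPolynomial.bind₁ (HPoly L κM c) P) =
        MvPolynomial.eval (fun J => MvPolynomial.eval (genFun L κM c w x ξ) (HPoly L κM c J)) P :=
      MvPolynomial.eval₂Hom_bind₁ _ _ _ _
    have hfun : (fun J => chartCoord L κM (baseIdx c) J (w + ξ • x)) =
        fun J => MvPolynomial.eval (genFun L κM c w x ξ) (HPoly L κM c J) :=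
      funext fun J => chartCoord_baseIdx_eq_eval κM c w x hξ J
    rw [hb, hfun]
  rw [heq.iteratedDeriv_eq k, iteratedDeriv_eval_genFun κM c w x _ k (hc x)]

end Std

end GaGmE

end Literature.NumberTheory.Transcendental

end
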